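import Literature.MathematicalPhysics.QuantumFieldTheory.Balaban1983to89.B16RLeafRecord13AtLive
import Literature.MathematicalPhysics.QuantumFieldTheory.Balaban1983to89.Node00.Record13SepCoPHChi
import Literature.MathematicalPhysics.QuantumFieldTheory.Balaban1983to89.Node00.Record13ResidualsRChi
import Literature.MathematicalPhysics.QuantumFieldTheory.Balaban1983to89.B16RLeafRecord13LiveChi
import Literature.MathematicalPhysics.QuantumFieldTheory.Balaban1983to89.Node00.Record13LiveSelectorChi

/-!
# χ-GENERIC RE-ISSUE (WORK ORDER RC-1 «RE-CENTRE THE RECORD», director-ym №462 (B) ∕ №467 (D)) of `B16RLeafRecord13AtLive`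

Cell `pub-ymgap` (HUMAN RULING D-0062, Track A), seat `pub-ymgap-dag-n11-d` (N11 [B14] s2; N11-σ campaign, `N11-G44-RC1-REACH-CENSUS.md`).  The CENTRE-TYPED
declarations of `B16RLeafRecord13AtLive` (those whose statement reads the (2.9) cut-off centre through `gOfRecord₁₃ ∕ EOfRecord₁₃ ∕ Provisos₁₃… ∕ T∕SLaw₁₃… ∕
UbgOfRecord₁₃… ∕ WtOfRecord₁₃… ∕ datum∕tower∕coreOfRecord₁₃…`) RE-ISSUED VERBATIM in the β-slot `χ : ChiSlot F N` over [Ax-3b]∕[Ax-3c]∕[Ax-3d]'s χ-generic carriers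
(`Node00/Record13Chi` ∕ `Record13CoPHChi` ∕ `Record13SepCoPHChi`): σ = (binder `(χ : ChiSlot F N)` after `θ`; Node00 defs `X ↦ XChi … χ`; Node00 rows `Y ↦ Y_chi`;
this lane's sibling modules `…Chi` for Summits-side dependencies); SAME short names in the sibling namespace `…B16RLeafRecord13AtLiveChi` (consumers switch by namespace);
the 48 centre-FREE declarations of the original are NOT copied — they are reused BY NAME (`open … (…)` below).  At `χ := chiβOfRecord₁₃ θ` every statement here is
DEFINITIONALLY the landed one ([Ax-3b]'s `rfl` receipts); at `χ := chiβOfRecord₁₃Ax θ` it is what the Ax-record's N11 machine reads.  Nothing of record edited (body-freeze №460 (2)).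

HONEST FRAMING.  Count-neutral kernel re-elaboration of landed N11 bookkeeping∕estimates in a parameter; every HYPOTHESIS of the original stays a hypothesis; nothing of
Bałaban asserted beyond what the original file proves; N11 NOT discharged; K-items untouched; counts unmoved.  One finite `𝕋⁴_{L^K}` programme at fixed `ε = L^{−K}` —
NOT ℝ⁴, NOT OS, NOT a mass gap, NOT Clay.  No `sorry`∕`instance`∕`notation`.  Sources: as the original module, plus [I] = [Balaban1987RG1] (2.9) p.266 (the cut-off's centre).
-/

noncomputable section

open MeasureTheory
open scoped BigOperators Matrix.Norms.L2Operator

namespace Literature.MathematicalPhysics.QuantumFieldTheory.Balaban1983to89.B16RLeafRecord13AtLiveChi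

open Literature.MathematicalPhysics.QuantumFieldTheory.Balaban1983to89.B16RLeafRecord13AtLive (rOpLeaf_VOfRecord₁₃_liveRepin₁₃ laws₁₃_liveRepin₁₃ rOperation_leavesP_liveRepin₁₃ slotsOfRecord_liveRepin₁₃_succ_eq_zero_of_not_liveSeq sLaw₁₃_all_liveRepin₁₃_of_thmP245 sLaw₁₃_all_liveRepin₁₃_of_thmP245LiveSeq b14_main_at_record₁₃_liveRepin₁₃ b14_main_at_record₁₃_liveRepin₁₃_of_lawsLive b14_main_of_isRecordOfRecord₁₃C_datum_liveRepin₁₃ thm1Printed_datumOfRecord₁₃_liveRepin₁₃_of_laws thm1Printed_datumOfRecord₁₃_liveRepin₁₃_of_lawsLive densOfRecord₁₃_succ_ae_eq_tdens_liveRepin₁₃ kappa_nonneg_theta13LiveOfFamily E0_nonneg_theta13LiveOfFamily B0_nonneg_theta13LiveOfFamily rOpLeaf_VOfRecord₁₃_theta13LiveOfFamily_of_provisos laws₁₃_theta13LiveOfFamily_of_provisos densOfRecord₁₃_succ_ae_eq_tdens_theta13LiveOfFamily thm1Printed_datumOfRecord₁₃_theta13LiveOfFamily_of_laws b14_main_at_record₁₃_theta13LiveOfFamily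 rOpLeaf_VOfRecord₁₃_theta13LiveOfRecord_of_provisos rOpLeaf_VOfRecord₁₃_theta13LiveOfRecord_of_bg laws₁₃_theta13LiveOfRecord_of_provisos rOperation_leavesP_theta13LiveOfRecord_of_provisos densOfRecord₁₃_succ_ae_eq_tdens_theta13LiveOfRecord b14_main_at_record₁₃_theta13LiveOfRecord thm1Printed_datumOfRecord₁₃_theta13LiveOfRecord_of_laws thm1Printed_datumOfRecord₁₃_theta13LiveOfRecord_of_lawsLive thm1Printed_datumOfRecord₁₃_theta13LiveOfRecord_of_bg_of_laws kappa_nonneg_theta13LiveOfFamily₂ E0_nonneg_theta13LiveOfFamily₂ B0_nonneg_theta13LiveOfFamily₂ rOpLeaf_VOfRecord₁₃_theta13LiveOfFamily₂_of_provisos laws₁₃_theta13LiveOfFamily₂_of_provisos densOfRecord₁₃_succ_ae_eq_tdens_theta13LiveOfFamily₂ thm1Printed_datumOfRecord₁₃_theta13LiveOfFamily₂_of_laws b14_main_at_record₁₃_theta13LiveOfFamily₂ rOpLeaf_VOfRecord₁₃_theta13LiveOfNumerics_of_provisos laws₁₃_theta13LiveOfNumerics_of_provisos densOfRecord₁₃_succ_ae_eq_tdens_theta13LiveOfNumerics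 thm1Printed_datumOfRecord₁₃_theta13LiveOfNumerics_of_laws b14_main_at_record₁₃_theta13LiveOfNumerics rOpLeaf_VOfRecord₁₃_theta13LiveOfNumerics_of_bg provisos₁₃_liveRepin₁₃_of_thm1Scaled rOpLeaf_VOfRecord₁₃_liveRepin₁₃_of_thm1Scaled laws₁₃_liveRepin₁₃_of_thm1Scaled rOpLeaf_VOfRecord₁₃_theta13LiveOfNumerics_of_thm1Scaled laws₁₃_theta13LiveOfNumerics_of_thm1Scaled)
open T4Continuum T4DatumAssembly Node00 B14.Eq218Concrete DagBinding
open B16RLeafRecord13Live hiding dead_of_ppSel_succ_ne_of_liveSel gOfRecord₁₃_succ_nonneg ppSel_succ_idem_of_liveSel slotsOfRecord₁₃_succ_eq_zero_of_dead slotsOfRecord₁₃_succ_eq_zero_of_not_mem_range slotsOfRecord₁₃_succ_eq_zero_of_slotsT_eq_zero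
open B16RLeafRecord13LiveChi

variable (F : T4Family) (N : ℕ) [NeZero N]

/-! ## §1  At every Stage-13 live re-pin `θ.liveRepin₁₃`: the selector clause is `rfl`; the leaf, the laws, the node, the (B)-face conjunct, 𝐑 = identity a.e. -/

section Repin

variable (θ : Stage13Params F N) (χ : ChiSlot F N) (p : B12.RunParams)

/-- **THE SELECTOR CLAUSE HOLDS AT THE RE-PIN BY `rfl`** (node00-def-T's §4c binder shape, read at `θ' := θ.liveRepin₁₃Chi F N χ` in `θ'`'s own letters).
[cite: Balaban1989LargeFieldI, (0.3) p.176 (bookkeeping); Balaban1988Convergent, (3.22) p.269] -/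
theorem liveRepin₁₃_liveSel :
    (θ.liveRepin₁₃Chi F N χ).ppSel = ppSelLiveOfRecord F N (θ.liveRepin₁₃Chi F N χ).ν (θ.liveRepin₁₃Chi F N χ).τ9 (EOfRecord₁₃Chi F N (θ.liveRepin₁₃Chi F N χ) χ)
      (wOfRecord₉ F N (θ.liveRepin₁₃Chi F N χ).toStage9Params) := rfl

variable (w : WorldP) (h : (θ.liveRepin₁₃Chi F N χ).Provisos₁₃Chi F N χ)

end Repin

/-! ## §2  At node00-def-K0a's family witness `θ₁₃(ε₀) = theta13LiveOfFamily F N ε₀ ζ Rz Zt`: admissibility and the term-constant signs DISCHARGED -/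

/-! ## §3  At the Stage-13 WITNESS OF RECORD `θ₁₃ = theta13LiveOfRecord F N`: every face hypothesis-free up to `Provisos₁₃` — and, through K0a's one-row reduction
`provisos₁₃_theta13LiveOfRecord_of_bg`, up to ROW P11 `bg` ALONE -/

/-! ## §4  At node00-def-K0a's OPEN-LETTER family `θ₁₃(ε₀, ε₂₉) = theta13LiveOfFamily₂ F N ε₀ ε₂₉ ζ Rz Zt` (FILE 9): admissibility and signs DISCHARGED -/

/-! ## §5  At node00-def-K0a's NUMERICS-GENERIC witness `θ₁₃(n) = theta13LiveOfNumerics F N n ε₂₉ ζ Rz Zt` (FILE 9 §3; every numeric letter a parameter — the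
witness dag-lead WORDS-131 ∕ ref-D ⚑ EPS-PIN direct the small-row consumers to): `n.Pos`, `0 < ε₂₉` and the three term-constant signs of `n` displayed -/

/-! ## §6  (v1.1) ★★ THE THREE DESKS' JUNCTION: at any live re-pin carrying K0b's residuals, N13's 𝐑-leaf — and `Provisos₁₃` itself — from seat node00-def-P11's
ROW-P11 SUPPLIER HYPOTHESES alone ([15] Thm 1 named fact + numerics clauses + the two gauge clauses), through node00-def-K0a's sockets -/

end Literature.MathematicalPhysics.QuantumFieldTheory.Balaban1983to89.B16RLeafRecord13AtLiveChi

end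

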